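import Literature.Analysis.FluidPDE.Tao2016AveragedNS.GateRetuning
import HarnessLib

/-!
# Tao 2016, §5.5 — cascade displacement bounds WITH DEFECT (approximate trajectories)

T. Tao, *Finite time blowup for an averaged three-dimensional Navier–Stokes equation*, J. Amer.
Math. Soc. **29** (2016) 601–674 = arXiv:1402.0290, §5.5 (the five-mode delay circuit (5.5));
E. Hairer, S. P. Nørsett, G. Wanner, *Solving ODE I* (2nd ed. 1993), §I.10, Theorem 10.2 (the
fundamental lemma: an approximate solution with defect `δ` stays `gronwallBound δ₀ L δ t`-close).

HONEST FRAMING (cell pub-fluidc, blueprint seat 1): low prior, high value-of-information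
experiment on Tao's machine paradigm; NOT a claim that NS blows up. No Navier–Stokes statement
here. Companion of `CascadeBounds.lean` (two EXACT trajectories): the same coordinatewise
rate/forcing splits for an exact trajectory `X` of a member `delayCircuitWith K M ε` of the retuned
family (`GateRetuning.lean`) against an APPROXIMATE trajectory `Y` — differentiable with velocity
`V t` whose defect `‖V t - F(Y t)‖ ≤ δ` on `[0,T)` (sup norm) — so that a forcing of the circuit
(the situation of the cell's shadowing / certificate files) enters each coordinate's scalar
Grönwall inequality as `+ δ` in the forcing slot and nowhere else:

* `abs_sub_apply_le_gronwallBound_of_defect` — the engine: split `F(Y)ᵢ - F(X)ᵢ = r·Wᵢ + g`,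
  `|r| ≤ Λ`, `|g| ≤ φ`, coordinate defect `|Vᵢ - F(Y)ᵢ| ≤ δ` ⇒ `|Wᵢ(t)| ≤ gronwallBound δ₀ Λ (φ + δ) t`;
* `trigger_sub_le_gronwallBound_of_defect` (`c`): rate `|ε⁻¹M|·sup|Y_b|`, no rotor term;
* `rotated_sub_le_gronwallBound_of_defect` (`d`): rate `|K|·sup|Y_ã|`, the `ε⁻²` only as forcing by `W_c`;
* `output_sub_le_of_defect` (`ã`), `clock_sub_le_of_defect` (`b`): affine `δ₀ + (φ + δ)t`;
* `carrier_sub_le_gronwallBound_of_defect` (`a`): rate `|ε|β + ε²e^{-M}γ`.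

This is the bookkeeping layer of the cell's conjectured "Theorem 5.3 for pseudo-orbits"
(`pub-fluidc-bp1/SPEC-INPUT-bp1.md` (D)(4)); closing the loop between the forcings is NOT done here.
-/

namespace Literature.Analysis.FluidPDE.Tao2016AveragedNS

open Set

variable {m : ℕ}

/-! ## The scalar engine with defect -/

/-- **Scalar Grönwall engine with defect.** `X` is an exact trajectory of `F`; `Y` is
differentiable with velocity `V t` and coordinate defect `|V s i - F(Y s) i| ≤ δ` on `[0,T)`; along
them the `i`-th increment splits as `F(Y s)ᵢ - F(X s)ᵢ = r s · (Y s i - X s i) + g s` with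
`|r| ≤ Λ`, `|g| ≤ φ` on `[0,T)`; and `|Y 0 i - X 0 i| ≤ δ₀`. Then
`|Y t i - X t i| ≤ gronwallBound δ₀ Λ (φ + δ) t` on `[0,T]`.
[cite: HairerNorsettWanner1993, Thm I.10.2] -/
theorem abs_sub_apply_le_gronwallBound_of_defect {F : (Fin m → ℝ) → (Fin m → ℝ)}
    {X Y : ℝ → Fin m → ℝ} {V : ℝ → Fin m → ℝ}
    (hX : ∀ t, HasDerivAt X (F (X t)) t) (hY : ∀ t, HasDerivAt Y (V t) t) (i : Fin m)
    {T δ δ₀ Λ φ : ℝ} (hV : ∀ s ∈ Ico 0 T, |V s i - F (Y s) i| ≤ δ) (r g : ℝ → ℝ)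
    (hsplit : ∀ s, F (Y s) i - F (X s) i = r s * (Y s i - X s i) + g s)
    (hr : ∀ s ∈ Ico 0 T, |r s| ≤ Λ) (hg : ∀ s ∈ Ico 0 T, |g s| ≤ φ)
    (h0 : |Y 0 i - X 0 i| ≤ δ₀) :
    ∀ t ∈ Icc 0 T, |Y t i - X t i| ≤ gronwallBound δ₀ Λ (φ + δ) t := by
  have hd : ∀ s, HasDerivAt (fun s => Y s i - X s i) (V s i - F (X s) i) s :=
    fun s => ((hasDerivAt_pi.1 (hY s)) i).sub ((hasDerivAt_pi.1 (hX s)) i)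
  have key := norm_le_gronwallBound_of_norm_deriv_right_le (f := fun s => Y s i - X s i)
    (f' := fun s => V s i - F (X s) i) (δ := δ₀) (K := Λ) (ε := φ + δ) (a := 0) (b := T)
    (fun s _ => (hd s).continuousAt.continuousWithinAt)
    (fun s _ => (hd s).hasDerivWithinAt) (by simpa [Real.norm_eq_abs] using h0) ?_
  · intro t ht
    simpa [Real.norm_eq_abs] using key t ht
  · intro s hs
    rw [Real.norm_eq_abs, Real.norm_eq_abs]
    have hdec : V s i - F (X s) i = (V s i - F (Y s) i) + (r s * (Y s i - X s i) + g s) := by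
      rw [← hsplit s]; ring
    rw [hdec]
    calc |V s i - F (Y s) i + (r s * (Y s i - X s i) + g s)|
        ≤ |V s i - F (Y s) i| + |r s * (Y s i - X s i) + g s| := abs_add_le _ _
      _ ≤ |V s i - F (Y s) i| + (|r s * (Y s i - X s i)| + |g s|) := by
          gcongr; exact abs_add_le _ _
      _ = |V s i - F (Y s) i| + (|r s| * |Y s i - X s i| + |g s|) := by rw [abs_mul]
      _ ≤ δ + (Λ * |Y s i - X s i| + φ) := by
          gcongr
          · exact hV s hs
          · exact hr s hs
          · exact hg s hs
      _ = Λ * |Y s i - X s i| + (φ + δ) := by ring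

/-- A sup-norm defect bound gives the coordinate defect bound the engine wants. [folklore] -/
theorem abs_coord_defect_le {V F : Fin m → ℝ} {δ : ℝ} (h : ‖V - F‖ ≤ δ) (i : Fin m) :
    |V i - F i| ≤ δ := by
  have := norm_le_pi_norm (V - F) i
  rw [Pi.sub_apply, Real.norm_eq_abs] at this
  exact this.trans h

/-! ## The five coordinates of the retuned circuit, with defect -/

section circuit

variable {K M ε T δ : ℝ} {X Y V : ℝ → Fin 5 → ℝ}
  (hX : ∀ t, HasDerivAt X (delayCircuitWith K M ε (X t)) t)
  (hY : ∀ t, HasDerivAt Y (V t) t)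
  (hV : ∀ s ∈ Ico 0 T, ‖V s - delayCircuitWith K M ε (Y s)‖ ≤ δ)
include hX hY hV

/-- **Trigger `c` (index 2), with defect**: rate `|ε⁻¹M|β` from `|Y_b| ≤ β`, forcing
`ε²e^{-M}(X_a+Y_a)W_a + ε⁻¹M·X_c·W_b` bounded by `φ`, no rotor term:
`|Y t 2 - X t 2| ≤ gronwallBound δ₀ (|ε⁻¹M|β) (φ + δ) t`. [cite: Tao2016AveragedNS, §5.5 (5.5)] -/
theorem trigger_sub_le_gronwallBound_of_defect {δ₀ β φ : ℝ} (hb : ∀ s ∈ Ico 0 T, |Y s 1| ≤ β)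
    (hφ : ∀ s ∈ Ico 0 T,
      |ε ^ 2 * Real.exp (-M) * (X s 0 + Y s 0) * (Y s 0 - X s 0) +
        ε⁻¹ * M * X s 2 * (Y s 1 - X s 1)| ≤ φ)
    (h0 : |Y 0 2 - X 0 2| ≤ δ₀) :
    ∀ t ∈ Icc 0 T, |Y t 2 - X t 2| ≤ gronwallBound δ₀ (|ε⁻¹ * M| * β) (φ + δ) t := by
  refine abs_sub_apply_le_gronwallBound_of_defect hX hY 2
    (fun s hs => abs_coord_defect_le (hV s hs) 2) (fun s => ε⁻¹ * M * Y s 1)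
    (fun s => ε ^ 2 * Real.exp (-M) * (X s 0 + Y s 0) * (Y s 0 - X s 0) +
      ε⁻¹ * M * X s 2 * (Y s 1 - X s 1)) (fun s => ?_) (fun s hs => ?_) hφ h0
  · simp [delayCircuitWith]; ring
  · rw [abs_mul]; exact mul_le_mul_of_nonneg_left (hb s hs) (abs_nonneg _)

/-- **Rotated mode `d` (index 3), with defect**: rate `|K|α` from `|Y_ã| ≤ α`; forcing
`ε⁻²(Y_a W_c + X_c W_a) - K·X_d·W_ã` bounded by `φ` (the `ε⁻²` multiplies the trigger
displacement; it is not in the exponent). [cite: Tao2016AveragedNS, §5.5 (5.5)] -/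
theorem rotated_sub_le_gronwallBound_of_defect {δ₀ α φ : ℝ} (hã : ∀ s ∈ Ico 0 T, |Y s 4| ≤ α)
    (hφ : ∀ s ∈ Ico 0 T,
      |(ε ^ 2)⁻¹ * (Y s 0 * (Y s 2 - X s 2) + X s 2 * (Y s 0 - X s 0)) -
        K * X s 3 * (Y s 4 - X s 4)| ≤ φ)
    (h0 : |Y 0 3 - X 0 3| ≤ δ₀) :
    ∀ t ∈ Icc 0 T, |Y t 3 - X t 3| ≤ gronwallBound δ₀ (|K| * α) (φ + δ) t := by
  refine abs_sub_apply_le_gronwallBound_of_defect hX hY 3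
    (fun s hs => abs_coord_defect_le (hV s hs) 3) (fun s => -(K * Y s 4))
    (fun s => (ε ^ 2)⁻¹ * (Y s 0 * (Y s 2 - X s 2) + X s 2 * (Y s 0 - X s 0)) -
      K * X s 3 * (Y s 4 - X s 4)) (fun s => ?_) (fun s hs => ?_) hφ h0
  · simp [delayCircuitWith]; ring
  · rw [abs_neg, abs_mul]; exact mul_le_mul_of_nonneg_left (hã s hs) (abs_nonneg _)

/-- **Output `ã` (index 4), with defect**: pure forcing `K(X_d+Y_d)W_d` bounded by `φ`:
`|Y t 4 - X t 4| ≤ δ₀ + (φ + δ)t`. [cite: Tao2016AveragedNS, §5.5 (5.5)] -/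
theorem output_sub_le_of_defect {δ₀ φ : ℝ}
    (hφ : ∀ s ∈ Ico 0 T, |K * (X s 3 + Y s 3) * (Y s 3 - X s 3)| ≤ φ)
    (h0 : |Y 0 4 - X 0 4| ≤ δ₀) :
    ∀ t ∈ Icc 0 T, |Y t 4 - X t 4| ≤ δ₀ + (φ + δ) * t := by
  intro t ht
  have h := abs_sub_apply_le_gronwallBound_of_defect hX hY 4 (Λ := 0)
    (fun s hs => abs_coord_defect_le (hV s hs) 4) (fun _ => 0)
    (fun s => K * (X s 3 + Y s 3) * (Y s 3 - X s 3)) (fun s => ?_) (fun s _ => by simp) hφ h0 t ht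
  · have e : gronwallBound δ₀ 0 (φ + δ) t = δ₀ + (φ + δ) * t := congrFun (gronwallBound_K0 δ₀ (φ + δ)) t
    rw [e] at h; exact h
  · simp [delayCircuitWith]; ring

/-- **Clock `b` (index 1), with defect**: pure forcing `ε(X_a+Y_a)W_a - ε⁻¹M(X_c+Y_c)W_c`
bounded by `φ`: `|Y t 1 - X t 1| ≤ δ₀ + (φ + δ)t`. [cite: Tao2016AveragedNS, §5.5 (5.5)] -/
theorem clock_sub_le_of_defect {δ₀ φ : ℝ}
    (hφ : ∀ s ∈ Ico 0 T,
      |ε * (X s 0 + Y s 0) * (Y s 0 - X s 0) - ε⁻¹ * M * (X s 2 + Y s 2) * (Y s 2 - X s 2)| ≤ φ)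
    (h0 : |Y 0 1 - X 0 1| ≤ δ₀) :
    ∀ t ∈ Icc 0 T, |Y t 1 - X t 1| ≤ δ₀ + (φ + δ) * t := by
  intro t ht
  have h := abs_sub_apply_le_gronwallBound_of_defect hX hY 1 (Λ := 0)
    (fun s hs => abs_coord_defect_le (hV s hs) 1) (fun _ => 0)
    (fun s => ε * (X s 0 + Y s 0) * (Y s 0 - X s 0) - ε⁻¹ * M * (X s 2 + Y s 2) * (Y s 2 - X s 2))
    (fun s => ?_) (fun s _ => by simp) hφ h0 t ht
  · have e : gronwallBound δ₀ 0 (φ + δ) t = δ₀ + (φ + δ) * t := congrFun (gronwallBound_K0 δ₀ (φ + δ)) t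
    rw [e] at h; exact h
  · simp [delayCircuitWith]; ring

/-- **Carrier `a` (index 0), with defect**: rate `|ε|β + ε²e^{-M}γ` from `|Y_b| ≤ β`, `|Y_c| ≤ γ`;
forcing `-ε⁻²(Y_d W_c + X_c W_d) - εX_a W_b - ε²e^{-M}X_a W_c` bounded by `φ`.
[cite: Tao2016AveragedNS, §5.5 (5.5)] -/
theorem carrier_sub_le_gronwallBound_of_defect {δ₀ β γ φ : ℝ}
    (hb : ∀ s ∈ Ico 0 T, |Y s 1| ≤ β) (hc : ∀ s ∈ Ico 0 T, |Y s 2| ≤ γ)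
    (hφ : ∀ s ∈ Ico 0 T,
      |-((ε ^ 2)⁻¹ * (Y s 3 * (Y s 2 - X s 2) + X s 2 * (Y s 3 - X s 3))) -
        ε * X s 0 * (Y s 1 - X s 1) - ε ^ 2 * Real.exp (-M) * X s 0 * (Y s 2 - X s 2)| ≤ φ)
    (h0 : |Y 0 0 - X 0 0| ≤ δ₀) :
    ∀ t ∈ Icc 0 T, |Y t 0 - X t 0| ≤
      gronwallBound δ₀ (|ε| * β + ε ^ 2 * Real.exp (-M) * γ) (φ + δ) t := by
  refine abs_sub_apply_le_gronwallBound_of_defect hX hY 0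
    (fun s hs => abs_coord_defect_le (hV s hs) 0)
    (fun s => -(ε * Y s 1 + ε ^ 2 * Real.exp (-M) * Y s 2))
    (fun s => -((ε ^ 2)⁻¹ * (Y s 3 * (Y s 2 - X s 2) + X s 2 * (Y s 3 - X s 3))) -
      ε * X s 0 * (Y s 1 - X s 1) - ε ^ 2 * Real.exp (-M) * X s 0 * (Y s 2 - X s 2))
    (fun s => ?_) (fun s hs => ?_) hφ h0
  · simp [delayCircuitWith]; ring
  · have hexp : 0 ≤ ε ^ 2 * Real.exp (-M) := by positivity
    rw [abs_neg]
    calc |ε * Y s 1 + ε ^ 2 * Real.exp (-M) * Y s 2|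
        ≤ |ε * Y s 1| + |ε ^ 2 * Real.exp (-M) * Y s 2| := abs_add_le _ _
      _ = |ε| * |Y s 1| + ε ^ 2 * Real.exp (-M) * |Y s 2| := by
          rw [abs_mul, abs_mul, abs_of_nonneg hexp]
      _ ≤ |ε| * β + ε ^ 2 * Real.exp (-M) * γ := by
          gcongr; exact hb s hs; exact hc s hs

end circuit

end Literature.Analysis.FluidPDE.Tao2016AveragedNS
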